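import Summits.NavierStokesRegularity.NavierStokesRegularity.Theorems.EfficiencyFloorMaximiserSetRigidityOrbitInvariance
import HarnessLib

/-!
# Route `EfficiencyFloor`, crux `MaximiserSetRigidity` (stmt-25512) / support `RigidExit` (stmt-25513) on the
# `ProductionEfficiencyDecay` ladder (stmt-22866): THE NORMALISED-MAXIMISER SET IS A UNION OF SYMMETRY ORBITS

Helper file (`--supports stmt-NavierStokesRegularity-22866`; line `efficiency_floor`). Sequel to
`…MaximiserSetRigidityOrbitInvariance` (p839411: `Z ↦ lZ`, `Pal ↦ l³Pal`, `S ↦ l³S` and transfer of the three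
normalised-maximiser identities along the orbit map `m ↦ (x ↦ l•R(m(l•R⁻¹(x − a))))`). Here the ADMISSIBLE CLASS of the
route decls (`ContDiff ℝ ⊤`, divergence free, `D⁰m, D¹m, D²m ∈ L²` as `lintegral`s of `iteratedFDeriv`) is shown to be
orbit invariant as well:

* `divergence_orbitSlice` (`div (g·m)(x) = l²·div m(y)`, no differentiability hypothesis), `isDivFree_orbitSlice`;
* `contDiff_orbitSlice`;
* `norm_iteratedFDeriv_orbitSlice_le` (`‖Dᵏ(g·m)(x)‖ ≤ l^{k+1}‖Dᵏm(y)‖` for smooth `m`, `l > 0`) and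
  `lintegral_iteratedFDeriv_orbitSlice_lt_top` (`Dᵏ(g·m) ∈ L²` from `Dᵏm ∈ L²`);
* `admissible_orbitSlice` — the admissible 5-tuple transfers;
* `normalisedMaximiser_orbitSlice` — **every point of the symmetry orbit of a normalised maximiser is a normalised
  maximiser** (the full clause of `MaximiserSetRigidity` (a) / `NearMaximiserBoundedAmplification`, verbatim shape,
  same `c`, same `ν`): the consistency fact behind "finitely many maximisers MODULO the symmetry group".

HONEST FRAMING: vector calculus and change of variables; clause (a), `RigidExit`, `NearMaximiserBoundedAmplification`,
`LerayFloorGap`, `ProductionEfficiencyDecay` (stmt-22866) and Navier–Stokes regularity stay OPEN; no summit statement is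
proved. [folklore]
-/

-- the problem directory repeats the summit name (`NavierStokesRegularity/NavierStokesRegularity`)
set_option linter.dupNamespace false

noncomputable section

open Set Filter MeasureTheory Topology Function Module
open scoped InnerProductSpace RealInnerProductSpace ENNReal NNReal ContDiff
open Literature.Analysis Literature.Analysis.FluidPDE

namespace Summit.NavierStokesRegularity.NavierStokesRegularity.Theorems

namespace MaximiserSetRigidity

namespace OrbitInvariance

open RigidExit.Resonance

/-! ## Divergence and smoothness -/

/-- **Divergence of an orbit slice**: `div (x ↦ l•R(m(l•R⁻¹(x − a))))(x) = l² · div m (l•R⁻¹(x − a))`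
(trace of `fderiv_orbitSlice`; no differentiability hypothesis). [folklore] -/
theorem divergence_orbitSlice (m : EuclideanSpace ℝ (Fin 3) → EuclideanSpace ℝ (Fin 3)) (a : EuclideanSpace ℝ (Fin 3))
    (R : EuclideanSpace ℝ (Fin 3) ≃ₗᵢ[ℝ] EuclideanSpace ℝ (Fin 3)) (l : ℝ) (x : EuclideanSpace ℝ (Fin 3)) :
    VectorCalculus.divergence (fun x => l • R (m (l • R.symm (x - a)))) x =
      l ^ 2 * VectorCalculus.divergence m (l • R.symm (x - a)) := by
  set v : EuclideanSpace ℝ (Fin 3) → EuclideanSpace ℝ (Fin 3) := fun z => l • m (l • z) with hv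
  set g : EuclideanSpace ℝ (Fin 3) → EuclideanSpace ℝ (Fin 3) := fun y => R (v (R.symm y)) with hg
  have hug : (fun x => l • R (m (l • R.symm (x - a)))) = fun x => g (x - a) := by
    funext x
    simp only [hg, hv, LinearIsometryEquiv.map_smul]
  have h1 : VectorCalculus.divergence (fun x => g (x - a)) x = VectorCalculus.divergence g (x - a) := by
    unfold VectorCalculus.divergence
    rw [fderiv_comp_sub]
  have h2 : VectorCalculus.divergence g (x - a) = VectorCalculus.divergence v (R.symm (x - a)) := by
    rw [hg]
    exact divergence_conj_linearIsometryEquiv R v (x - a)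
  have h3 : VectorCalculus.divergence v (R.symm (x - a)) = l ^ 2 * VectorCalculus.divergence m (l • R.symm (x - a)) := by
    unfold VectorCalculus.divergence
    rw [hv, fderiv_const_smul_comp_smul_apply, ContinuousLinearMap.toLinearMap_smul, map_smul, smul_eq_mul, sq]
  rw [hug, h1, h2, h3]

/-- A divergence-free field has divergence-free orbit slices. [folklore] -/
theorem isDivFree_orbitSlice {m : EuclideanSpace ℝ (Fin 3) → EuclideanSpace ℝ (Fin 3)}
    (hm : VectorCalculus.IsDivFree m) (a : EuclideanSpace ℝ (Fin 3))
    (R : EuclideanSpace ℝ (Fin 3) ≃ₗᵢ[ℝ] EuclideanSpace ℝ (Fin 3)) (l : ℝ) :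
    VectorCalculus.IsDivFree (fun x => l • R (m (l • R.symm (x - a)))) := fun x => by
  rw [divergence_orbitSlice, hm, mul_zero]

/-- Smoothness transfers along the orbit map. [folklore] -/
theorem contDiff_orbitSlice {m : EuclideanSpace ℝ (Fin 3) → EuclideanSpace ℝ (Fin 3)} {n : WithTop ℕ∞}
    (hm : ContDiff ℝ n m) (a : EuclideanSpace ℝ (Fin 3))
    (R : EuclideanSpace ℝ (Fin 3) ≃ₗᵢ[ℝ] EuclideanSpace ℝ (Fin 3)) (l : ℝ) :
    ContDiff ℝ n (fun x => l • R (m (l • R.symm (x - a)))) :=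
  (R.contDiff.comp (hm.comp ((R.symm.contDiff.comp (contDiff_id.sub contDiff_const)).const_smul l))).const_smul l

/-! ## `Dᵏ` of an orbit slice: norm bound and square integrability -/

/-- **Norm bound for the iterated derivatives of an orbit slice**: for smooth `m` and `l > 0`,
`‖Dᵏ(x ↦ l•R(m(l•R⁻¹(x − a))))(x)‖ ≤ l^{k+1} · ‖Dᵏm (l•R⁻¹(x − a))‖` (in fact equality). [folklore] -/
theorem norm_iteratedFDeriv_orbitSlice_le {m : EuclideanSpace ℝ (Fin 3) → EuclideanSpace ℝ (Fin 3)}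
    (hm : ContDiff ℝ (⊤ : ℕ∞) m) (a : EuclideanSpace ℝ (Fin 3))
    (R : EuclideanSpace ℝ (Fin 3) ≃ₗᵢ[ℝ] EuclideanSpace ℝ (Fin 3)) {l : ℝ} (hl : 0 < l) (k : ℕ)
    (x : EuclideanSpace ℝ (Fin 3)) :
    ‖iteratedFDeriv ℝ k (fun x => l • R (m (l • R.symm (x - a)))) x‖ ≤
      l ^ (k + 1) * ‖iteratedFDeriv ℝ k m (l • R.symm (x - a))‖ := by
  -- the dilation `z ↦ l • z` as a continuous linear map
  set L : EuclideanSpace ℝ (Fin 3) →L[ℝ] EuclideanSpace ℝ (Fin 3) := l • ContinuousLinearMap.id ℝ _ with hL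
  have hLz : ∀ z, L z = l • z := fun z => by simp [hL]
  have hwc : ContDiff ℝ (k : WithTop ℕ∞) (m ∘ (L : EuclideanSpace ℝ (Fin 3) → EuclideanSpace ℝ (Fin 3))) :=
    (hm.of_le (by exact_mod_cast le_top)).comp L.contDiff
  have hslice : (fun x => l • R (m (l • R.symm (x - a)))) =
      fun x => ((R : EuclideanSpace ℝ (Fin 3) → EuclideanSpace ℝ (Fin 3)) ∘
        ((l • (m ∘ (L : EuclideanSpace ℝ (Fin 3) → EuclideanSpace ℝ (Fin 3)))) ∘
          (R.symm : EuclideanSpace ℝ (Fin 3) → EuclideanSpace ℝ (Fin 3)))) (x - a) := by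
    funext x
    simp only [comp_apply, Pi.smul_apply, hLz, LinearIsometryEquiv.map_smul]
  rw [hslice, iteratedFDeriv_comp_sub, LinearIsometryEquiv.norm_iteratedFDeriv_comp_left,
    LinearIsometryEquiv.norm_iteratedFDeriv_comp_right, iteratedFDeriv_const_smul_apply hwc.contDiffAt,
    L.iteratedFDeriv_comp_right hm _ (by exact_mod_cast le_top), norm_smul, Real.norm_eq_abs, abs_of_pos hl, hLz,
    pow_succ, mul_comm (l ^ k) l, mul_assoc]
  refine mul_le_mul_of_nonneg_left ?_ hl.le
  refine (ContinuousMultilinearMap.norm_compContinuousLinearMap_le _ _).trans ?_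
  rw [mul_comm]
  refine mul_le_mul_of_nonneg_right ?_ (norm_nonneg _)
  rw [Finset.prod_const, Finset.card_univ, Fintype.card_fin]
  refine pow_le_pow_left₀ (norm_nonneg _) ?_ k
  calc ‖L‖ ≤ ‖l‖ * ‖ContinuousLinearMap.id ℝ (EuclideanSpace ℝ (Fin 3))‖ := by
        rw [hL]; exact norm_smul_le l (ContinuousLinearMap.id ℝ (EuclideanSpace ℝ (Fin 3)))
    _ ≤ l := by
        rw [Real.norm_eq_abs, abs_of_pos hl]
        exact mul_le_of_le_one_right hl.le ContinuousLinearMap.norm_id_le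

/-- Change of variables under the orbit map for `lintegral`s: `∫⁻ F(l•R⁻¹(x − a)) dx = (l³)⁻¹ ∫⁻ F` (`l > 0`). [folklore] -/
theorem lintegral_comp_orbitMap (F : EuclideanSpace ℝ (Fin 3) → ℝ≥0∞) (a : EuclideanSpace ℝ (Fin 3))
    (R : EuclideanSpace ℝ (Fin 3) ≃ₗᵢ[ℝ] EuclideanSpace ℝ (Fin 3)) {l : ℝ} (hl : 0 < l) :
    ∫⁻ x, F (l • R.symm (x - a)) = ENNReal.ofReal ((l ^ 3)⁻¹) * ∫⁻ x, F x := by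
  rw [lintegral_sub_right_eq_self (fun y => F (l • R.symm y)) a]
  have hR : ∫⁻ y, F (l • R.symm y) = ∫⁻ z, F (l • z) :=
    R.symm.measurePreserving.lintegral_comp_emb R.symm.toHomeomorph.measurableEmbedding (fun z => F (l • z))
  rw [hR]
  -- adapted from `Literature.Analysis.FluidPDE.RusinSverakCompactnessProofs.lintegral_comp_smul`
  have hc0 : l ≠ 0 := hl.ne'
  let e : EuclideanSpace ℝ (Fin 3) ≃ᵐ EuclideanSpace ℝ (Fin 3) :=
    (Homeomorph.smul (isUnit_iff_ne_zero.2 hc0).unit).toMeasurableEquiv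
  have he : (e : EuclideanSpace ℝ (Fin 3) → EuclideanSpace ℝ (Fin 3)) = fun x => l • x := rfl
  calc ∫⁻ x, F (l • x) = ∫⁻ y, F y ∂(Measure.map (fun x => l • x) volume) := by
        rw [← he, lintegral_map_equiv]; rfl
    _ = ENNReal.ofReal ((l ^ 3)⁻¹) * ∫⁻ x, F x := by
        rw [Measure.map_addHaar_smul volume hc0, lintegral_smul_measure, finrank_euclideanSpace_fin,
          abs_of_nonneg (by positivity), smul_eq_mul]

/-- **`Dᵏ` of an orbit slice is square integrable when `Dᵏm` is** (smooth `m`, `l > 0`). [folklore] -/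
theorem lintegral_iteratedFDeriv_orbitSlice_lt_top {m : EuclideanSpace ℝ (Fin 3) → EuclideanSpace ℝ (Fin 3)}
    (hm : ContDiff ℝ (⊤ : ℕ∞) m) (a : EuclideanSpace ℝ (Fin 3))
    (R : EuclideanSpace ℝ (Fin 3) ≃ₗᵢ[ℝ] EuclideanSpace ℝ (Fin 3)) {l : ℝ} (hl : 0 < l) {k : ℕ}
    (hk : ∫⁻ x, ‖iteratedFDeriv ℝ k m x‖ₑ ^ 2 < ⊤) :
    ∫⁻ x, ‖iteratedFDeriv ℝ k (fun x => l • R (m (l • R.symm (x - a)))) x‖ₑ ^ 2 < ⊤ := by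
  have hpt : ∀ x, ‖iteratedFDeriv ℝ k (fun x => l • R (m (l • R.symm (x - a)))) x‖ₑ ^ 2 ≤
      ENNReal.ofReal ((l ^ (k + 1)) ^ 2) * (fun y => ‖iteratedFDeriv ℝ k m y‖ₑ ^ 2) (l • R.symm (x - a)) := by
    intro x
    have h := norm_iteratedFDeriv_orbitSlice_le hm a R hl k x
    have h2 : ‖iteratedFDeriv ℝ k (fun x => l • R (m (l • R.symm (x - a)))) x‖ ^ 2 ≤
        (l ^ (k + 1)) ^ 2 * ‖iteratedFDeriv ℝ k m (l • R.symm (x - a))‖ ^ 2 := by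
      rw [← mul_pow]
      exact pow_le_pow_left₀ (norm_nonneg _) h 2
    calc ‖iteratedFDeriv ℝ k (fun x => l • R (m (l • R.symm (x - a)))) x‖ₑ ^ 2
          = ENNReal.ofReal (‖iteratedFDeriv ℝ k (fun x => l • R (m (l • R.symm (x - a)))) x‖ ^ 2) := by
            rw [ENNReal.ofReal_pow (norm_nonneg _), ofReal_norm]
      _ ≤ ENNReal.ofReal ((l ^ (k + 1)) ^ 2 * ‖iteratedFDeriv ℝ k m (l • R.symm (x - a))‖ ^ 2) :=
            ENNReal.ofReal_le_ofReal h2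
      _ = ENNReal.ofReal ((l ^ (k + 1)) ^ 2) * ‖iteratedFDeriv ℝ k m (l • R.symm (x - a))‖ₑ ^ 2 := by
            rw [ENNReal.ofReal_mul (sq_nonneg _), ENNReal.ofReal_pow (norm_nonneg _), ofReal_norm]
  calc ∫⁻ x, ‖iteratedFDeriv ℝ k (fun x => l • R (m (l • R.symm (x - a)))) x‖ₑ ^ 2
        ≤ ∫⁻ x, ENNReal.ofReal ((l ^ (k + 1)) ^ 2) * (fun y => ‖iteratedFDeriv ℝ k m y‖ₑ ^ 2) (l • R.symm (x - a)) :=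
          lintegral_mono hpt
    _ = ENNReal.ofReal ((l ^ (k + 1)) ^ 2) * (ENNReal.ofReal ((l ^ 3)⁻¹) * ∫⁻ x, ‖iteratedFDeriv ℝ k m x‖ₑ ^ 2) := by
          rw [lintegral_const_mul' _ _ ENNReal.ofReal_ne_top,
            lintegral_comp_orbitMap (fun y => ‖iteratedFDeriv ℝ k m y‖ₑ ^ 2) a R hl]
    _ < ⊤ := ENNReal.mul_lt_top ENNReal.ofReal_lt_top (ENNReal.mul_lt_top ENNReal.ofReal_lt_top hk)

/-! ## The admissible class and the normalised-maximiser set are unions of orbits -/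

/-- **The admissible class is orbit invariant**: smooth, divergence free, `D⁰, D¹, D² ∈ L²` transfer along
`m ↦ (x ↦ l•R(m(l•R⁻¹(x − a))))` (`l > 0`). [folklore] -/
theorem admissible_orbitSlice {m : EuclideanSpace ℝ (Fin 3) → EuclideanSpace ℝ (Fin 3)}
    (hm : ContDiff ℝ (⊤ : ℕ∞) m ∧ Literature.Analysis.FluidPDE.VectorCalculus.IsDivFree m ∧
      (∫⁻ x, ‖iteratedFDeriv ℝ 0 m x‖ₑ ^ 2 < ⊤) ∧ (∫⁻ x, ‖iteratedFDeriv ℝ 1 m x‖ₑ ^ 2 < ⊤) ∧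
      (∫⁻ x, ‖iteratedFDeriv ℝ 2 m x‖ₑ ^ 2 < ⊤))
    (a : EuclideanSpace ℝ (Fin 3)) (R : EuclideanSpace ℝ (Fin 3) ≃ₗᵢ[ℝ] EuclideanSpace ℝ (Fin 3)) {l : ℝ} (hl : 0 < l) :
    ContDiff ℝ (⊤ : ℕ∞) (fun x => l • R (m (l • R.symm (x - a)))) ∧
      Literature.Analysis.FluidPDE.VectorCalculus.IsDivFree (fun x => l • R (m (l • R.symm (x - a)))) ∧
      (∫⁻ x, ‖iteratedFDeriv ℝ 0 (fun x => l • R (m (l • R.symm (x - a)))) x‖ₑ ^ 2 < ⊤) ∧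
      (∫⁻ x, ‖iteratedFDeriv ℝ 1 (fun x => l • R (m (l • R.symm (x - a)))) x‖ₑ ^ 2 < ⊤) ∧
      (∫⁻ x, ‖iteratedFDeriv ℝ 2 (fun x => l • R (m (l • R.symm (x - a)))) x‖ₑ ^ 2 < ⊤) :=
  ⟨contDiff_orbitSlice hm.1 a R l, isDivFree_orbitSlice hm.2.1 a R l,
    lintegral_iteratedFDeriv_orbitSlice_lt_top hm.1 a R hl hm.2.2.1,
    lintegral_iteratedFDeriv_orbitSlice_lt_top hm.1 a R hl hm.2.2.2.1,
    lintegral_iteratedFDeriv_orbitSlice_lt_top hm.1 a R hl hm.2.2.2.2⟩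

/-- **Every point of the symmetry orbit of a normalised maximiser is a normalised maximiser** (the normalised-maximiser
clause of `MaximiserSetRigidity` (a) / `NearMaximiserBoundedAmplification` / `RigidExit`, verbatim shape, for the same
constant `c` and viscosity `ν`; `l > 0`). [folklore] -/
theorem normalisedMaximiser_orbitSlice {c ν : ℝ} {m : EuclideanSpace ℝ (Fin 3) → EuclideanSpace ℝ (Fin 3)}
    (hm : ((ContDiff ℝ (⊤ : ℕ∞) m ∧ Literature.Analysis.FluidPDE.VectorCalculus.IsDivFree m ∧
      (∫⁻ x, ‖iteratedFDeriv ℝ 0 m x‖ₑ ^ 2 < ⊤) ∧ (∫⁻ x, ‖iteratedFDeriv ℝ 1 m x‖ₑ ^ 2 < ⊤) ∧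
      (∫⁻ x, ‖iteratedFDeriv ℝ 2 m x‖ₑ ^ 2 < ⊤)) ∧ 0 < (∫ x, ‖Literature.Analysis.FluidPDE.curl m x‖ ^ 2) ∧
      (∫ x, ⟪Literature.Analysis.FluidPDE.curl m x, fderiv ℝ m x (Literature.Analysis.FluidPDE.curl m x)⟫_ℝ) =
        c * (∫ x, ‖Literature.Analysis.FluidPDE.curl m x‖ ^ 2) ^ (3 / 4 : ℝ) *
          (∫ x, Literature.Analysis.FluidPDE.frobeniusNormSq (fderiv ℝ (Literature.Analysis.FluidPDE.curl m) x)) ^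
            (3 / 4 : ℝ) ∧
      (∫ x, Literature.Analysis.FluidPDE.frobeniusNormSq (fderiv ℝ (Literature.Analysis.FluidPDE.curl m) x)) =
        81 * c ^ 4 / (256 * ν ^ 4) * (∫ x, ‖Literature.Analysis.FluidPDE.curl m x‖ ^ 2) ^ 3))
    (a : EuclideanSpace ℝ (Fin 3)) (R : EuclideanSpace ℝ (Fin 3) ≃ₗᵢ[ℝ] EuclideanSpace ℝ (Fin 3)) {l : ℝ} (hl : 0 < l) :
    (ContDiff ℝ (⊤ : ℕ∞) (fun x => l • R (m (l • R.symm (x - a)))) ∧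
      Literature.Analysis.FluidPDE.VectorCalculus.IsDivFree (fun x => l • R (m (l • R.symm (x - a)))) ∧
      (∫⁻ x, ‖iteratedFDeriv ℝ 0 (fun x => l • R (m (l • R.symm (x - a)))) x‖ₑ ^ 2 < ⊤) ∧
      (∫⁻ x, ‖iteratedFDeriv ℝ 1 (fun x => l • R (m (l • R.symm (x - a)))) x‖ₑ ^ 2 < ⊤) ∧
      (∫⁻ x, ‖iteratedFDeriv ℝ 2 (fun x => l • R (m (l • R.symm (x - a)))) x‖ₑ ^ 2 < ⊤)) ∧
    0 < (∫ x, ‖Literature.Analysis.FluidPDE.curl (fun x => l • R (m (l • R.symm (x - a)))) x‖ ^ 2) ∧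
    (∫ x, ⟪Literature.Analysis.FluidPDE.curl (fun x => l • R (m (l • R.symm (x - a)))) x,
        fderiv ℝ (fun x => l • R (m (l • R.symm (x - a)))) x
          (Literature.Analysis.FluidPDE.curl (fun x => l • R (m (l • R.symm (x - a)))) x)⟫_ℝ) =
      c * (∫ x, ‖Literature.Analysis.FluidPDE.curl (fun x => l • R (m (l • R.symm (x - a)))) x‖ ^ 2) ^ (3 / 4 : ℝ) *
        (∫ x, Literature.Analysis.FluidPDE.frobeniusNormSq
          (fderiv ℝ (Literature.Analysis.FluidPDE.curl (fun x => l • R (m (l • R.symm (x - a))))) x)) ^ (3 / 4 : ℝ) ∧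
    (∫ x, Literature.Analysis.FluidPDE.frobeniusNormSq
        (fderiv ℝ (Literature.Analysis.FluidPDE.curl (fun x => l • R (m (l • R.symm (x - a))))) x)) =
      81 * c ^ 4 / (256 * ν ^ 4) *
        (∫ x, ‖Literature.Analysis.FluidPDE.curl (fun x => l • R (m (l • R.symm (x - a)))) x‖ ^ 2) ^ 3 :=
  ⟨admissible_orbitSlice hm.1 a R hl, normalisedMaximiser_identities_orbitSlice m a R hl hm.2.1 hm.2.2.1 hm.2.2.2⟩

end OrbitInvariance

end MaximiserSetRigidity

end Summit.NavierStokesRegularity.NavierStokesRegularity.Theorems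

end
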